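import Summits.CriticalPhenomena.SAWScalingLimit.Theorems.SAWReversalUpgradeAttachReversalPlateau
import Summits.CriticalPhenomena.SAWScalingLimit.Theorems.SAWReversalUpgradeAttachReversalAssemblyA

/-!
# `AttachReversal` as literally filed depends on an unspecified `Classical.choice`

Route `SAWReversalUpgrade`, item `AttachReversal` (stmt-CriticalPhenomena-18007). The route's
statement quantifies over ALL `γ : DomainSAW D.carrier δ u v`, including the trivial walk `nil` at a
lattice site `u = v` whose mesh point `m` lies OUTSIDE `closure D` (the type allows it: `nil` is a
self-avoiding walk of the discrete domain between any site and itself). For such a walk the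
attachment reads `ψ₁ m = Function.invFunOn Φ ℍ̄ m`, which — `m` having no preimage — is the junk
value `J := Classical.choice ‹Nonempty ℂ›`, and the prescribed traces become
`S₁ = {a, b} ∪ Φ (ray through A_e J)` and `S₁' = {a, b} ∪ Φ' (ray through A_e J) = {a, b} ∪
Φ (ray through ι (A_e J))`. These are honest simple arcs from `a` to `b` through `D`, so curves
`c`, `c'` satisfying ALL hypotheses exist, and they have different traces unless `A_e J ∈ iℝ`, i.e.
unless `J ∈ iℝ`.

`AttachReversal_false_of_choice` : if `J` lies in the open upper half-plane off the imaginary axis,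
`AttachReversal` is FALSE. Since nothing whatsoever is provable about `Classical.choice ‹Nonempty ℂ›`,
the literal item can be neither proved nor refuted; the repaired statement (extra hypothesis
`meshPoint δ u ∈ closure D.carrier`) is the theorem `attachReversal_repaired` of the Final file.
-/

noncomputable section

open Set Function Filter Topology Complex Metric
open UpperHalfPlane (upperHalfPlaneSet)
open Literature.Probability.RandomPlanarGeometry hiding affineInterp
open Literature.Probability.LatticeModels Literature.Probability.Percolation

namespace Summit.CriticalPhenomena.SAWScalingLimit.Theorems.AttachReversal

/-! ### The attachment data of a constant polyline off the marked points -/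

section Const

variable {x y m : ℂ} {Φ : ℂ → ℂ} {e : ℝ} {w₀ : ℂ}

/-- **Constant polyline `R ≡ m`, `m ∉ {x, y}`**: if `Φ` is injective along the ray of the direction
`w₀ = A_e (ψ m)` (at the base point), then `uMid = 0`, `vMid = 1` and the prescribed trace is the
full ray `{x, y} ∪ Φ ((0, ∞) · w₀)`. -/
theorem const_generic_data (hxm : x ≠ m) (hmy : m ≠ y) (hw₀ : squeeze e (hinv Φ m) = w₀)
    (hinj : ∀ s : ℝ, 0 < s → Φ ((s : ℂ) * w₀) = Φ w₀ → s = 1) :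
    uMid x y Φ e (fun _ : ℝ => m) = 0 ∧ vMid x y Φ e (fun _ : ℝ => m) = 1 ∧
    attSet x y Φ e (fun _ : ℝ => m) = {x, y} ∪ ((fun s : ℝ => Φ ((s : ℂ) * w₀)) '' Ioi 0) := by
  have hi : lastA x (fun _ : ℝ => m) = 0 := (lastA_firstB_const_snd (y := m) hxm).1
  have hj : firstB y (fun _ : ℝ => m) = 1 := (lastA_firstB_const_fst (x := m) hmy).2
  have hZ : ∀ u, attZ y Φ e (fun _ : ℝ => m) u = Φ w₀ := fun u => by
    rw [attZ_of_ne (show (fun _ : ℝ => m) u ≠ y from hmy), hw₀]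
  have hM : midSet x y Φ e (fun _ : ℝ => m) = {Φ w₀} := by
    unfold midSet
    rw [hi, hj, show attZ y Φ e (fun _ : ℝ => m) = fun _ => Φ w₀ from funext hZ]
    exact (nonempty_Icc.2 zero_le_one).image_const (Φ w₀)
  have hp : pAcc x Φ e (fun _ : ℝ => m) = w₀ := by unfold pAcc; exact hw₀
  have hq : qEx y Φ e (fun _ : ℝ => m) = w₀ := by unfold qEx; exact hw₀
  have h1w : Φ (((1:ℝ) : ℂ) * w₀) = Φ w₀ := by rw [Complex.ofReal_one, one_mul]
  have hs : sAcc x y Φ e (fun _ : ℝ => m) = 1 := by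
    unfold sAcc
    rw [hp, hM]
    have : {s : ℝ | s ∈ Ioc (0:ℝ) 1 ∧ Φ ((s : ℂ) * w₀) ∈ ({Φ w₀} : Set ℂ)} = {1} := by
      ext s
      simp only [mem_setOf_eq, mem_singleton_iff, mem_Ioc]
      exact ⟨fun h => hinj s h.1.1 h.2, fun h => by subst h; exact ⟨⟨zero_lt_one, le_rfl⟩, h1w⟩⟩
    rw [this, csInf_singleton]
  have hr : rEx x y Φ e (fun _ : ℝ => m) = 1 := by
    unfold rEx
    rw [hq, hM, hj]
    have : {r : ℝ | 1 ≤ r ∧ (fun _ : ℝ => m) (1:ℝ) ≠ y ∧ Φ ((r : ℂ) * w₀) ∈ ({Φ w₀} : Set ℂ)} = {1} := by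
      ext r
      simp only [mem_setOf_eq, mem_singleton_iff]
      exact ⟨fun h => hinj r (zero_lt_one.trans_le h.1) h.2.2, fun h => by subst h; exact ⟨le_rfl, hmy, h1w⟩⟩
    rw [this, union_self, csSup_singleton]
  have hu : uMid x y Φ e (fun _ : ℝ => m) = 0 := by
    unfold uMid
    rw [hi, hj, hs, hp]
    have : {u : ℝ | u ∈ Icc (0:ℝ) 1 ∧ attZ y Φ e (fun _ : ℝ => m) u = Φ (((1:ℝ) : ℂ) * w₀)} = Icc 0 1 := by
      ext u; simp only [mem_setOf_eq, hZ u, h1w, and_true]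
    rw [this, csInf_Icc zero_le_one]
  have hv : vMid x y Φ e (fun _ : ℝ => m) = 1 := by
    unfold vMid
    rw [hi, hj, hr, hq]
    have h1 : {u : ℝ | u ∈ Icc (0:ℝ) 1 ∧ (fun _ : ℝ => m) (1:ℝ) = y ∧ u = 1} = ∅ := by
      ext u; simp only [mem_setOf_eq, mem_empty_iff_false, iff_false, not_and]
      exact fun _ h _ => hmy h
    have h2 : {u : ℝ | u ∈ Icc (0:ℝ) 1 ∧ (fun _ : ℝ => m) (1:ℝ) ≠ y ∧
        attZ y Φ e (fun _ : ℝ => m) u = Φ (((1:ℝ) : ℂ) * w₀)} = Icc 0 1 := by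
      ext u; simp only [mem_setOf_eq, hZ u, h1w, and_true]
      exact ⟨fun h => h.1, fun h => ⟨h, hmy⟩⟩
    rw [h1, h2, empty_union, csSup_Icc zero_le_one]
  refine ⟨hu, hv, ?_⟩
  unfold attSet
  rw [hp, hq, hs, hr, hu, hv, hj, show attZ y Φ e (fun _ : ℝ => m) = fun _ => Φ w₀ from funext hZ,
    (nonempty_Icc.2 zero_le_one).image_const (Φ w₀)]
  ext z
  constructor
  · rintro ((((h | h) | ⟨s, hs, rfl⟩) | h) | ⟨r, hr, rfl⟩)
    · exact Or.inl (Or.inl h)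
    · exact Or.inl (Or.inr h)
    · exact Or.inr ⟨s, hs.1, rfl⟩
    · refine Or.inr ⟨1, mem_Ioi.2 zero_lt_one, ?_⟩
      show Φ (((1:ℝ) : ℂ) * w₀) = z
      rw [h1w]; exact (mem_singleton_iff.1 h).symm
    · exact Or.inr ⟨r, zero_lt_one.trans_le hr.1, rfl⟩
  · rintro ((h | h) | ⟨s, hs, rfl⟩)
    · exact Or.inl (Or.inl (Or.inl (Or.inl h)))
    · exact Or.inl (Or.inl (Or.inl (Or.inr h)))
    · rcases le_or_gt s 1 with hs1 | hs1
      · exact Or.inl (Or.inl (Or.inr ⟨s, ⟨hs, hs1⟩, rfl⟩))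
      · exact Or.inr ⟨s, ⟨hs1.le, hmy⟩, rfl⟩

end Const

/-! ### A ray of `ℍ` through a uniformizer is a simple arc from `a` to `b` -/

/-- **The image `{a, b} ∪ Φ ((0, ∞) · w)` of a ray of `ℍ` is the range of an injective curve from
`a` to `b` with interior in `D`** (same gluing as the sibling `fallback_curve`, which is the case
`w = i`). -/
theorem ray_curve {D : Set ℂ} {Φ : ℂ → ℂ} {a b w : ℂ} (hab : a ≠ b) (hΦc : ContinuousOn Φ {z : ℂ | 0 ≤ z.im})
    (hinj : InjOn Φ {z : ℂ | 0 ≤ z.im}) (hΦ0 : Φ 0 = a) (hΦD : ∀ z : ℂ, 0 < z.im → Φ z ∈ D)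
    (hΦb : ∀ z : ℂ, 0 ≤ z.im → Φ z ≠ b)
    (hΦinf : Tendsto Φ (cocompact ℂ ⊓ 𝓟 {z : ℂ | 0 ≤ z.im}) (𝓝 b)) (hw : 0 < w.im) :
    ∃ c : Curve ℂ, Injective c ∧ c.source = a ∧ c.target = b ∧ (∀ t, c t = a ∨ c t = b ∨ c t ∈ D) ∧
      range c = {a, b} ∪ ((fun s : ℝ => Φ ((s : ℂ) * w)) '' Ioi 0) := by
  have hw' : 0 ≤ w.im := hw.le
  have hw0 : w ≠ 0 := by intro h; rw [h] at hw; simp at hw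
  have h0 : Φ (((0 : ℝ) : ℂ) * w) = a := by rw [Complex.ofReal_zero, zero_mul, hΦ0]
  have h1 := arcs_segment hΦc hinj hw' zero_le_one (Or.inl hw0)
  have h2 := arcs_ray hΦc hinj hΦb hΦinf hw' hw0 zero_lt_one
  rw [Complex.ofReal_one] at h1 h2
  have hmeet : (fun s : ℝ => Φ ((s : ℂ) * w)) '' Icc 0 1 ∩
      ((fun r : ℝ => Φ ((r : ℂ) * w)) '' Ici 1 ∪ {b}) ⊆ {Φ ((1 : ℂ) * w)} := by
    rintro x ⟨⟨s, hs, rfl⟩, hx⟩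
    rcases hx with ⟨r, hr, hrs⟩ | hxb
    · have h := hinj (ray_im_nonneg hw' (zero_le_one.trans hr)) (ray_im_nonneg hw' hs.1) hrs
      have h' : (r : ℂ) = s := mul_right_cancel₀ hw0 h
      have h'' : r = s := by exact_mod_cast h'
      have hs1 : s = 1 := le_antisymm hs.2 (h'' ▸ hr)
      rw [mem_singleton_iff]
      simp only [hs1, Complex.ofReal_one]
    · exact absurd hxb (hΦb _ (ray_im_nonneg hw' hs.1))
  have h3 := arcs_append h1 (Or.inr h2) hmeet
  rw [h0] at h3
  obtain ⟨c, hc, hcs, hct, hrange⟩ := arcs_exists_curve hab h3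
  have htrace : (fun s : ℝ => Φ ((s : ℂ) * w)) '' Icc 0 1 ∪
      ((fun r : ℝ => Φ ((r : ℂ) * w)) '' Ici 1 ∪ {b}) = {a, b} ∪ ((fun s : ℝ => Φ ((s : ℂ) * w)) '' Ioi 0) := by
    ext x
    simp only [mem_union, mem_image, mem_Icc, mem_Ici, mem_singleton_iff, mem_insert_iff, mem_Ioi]
    constructor
    · rintro (⟨s, ⟨hs0, hs1⟩, rfl⟩ | ⟨r, hr, rfl⟩ | rfl)
      · rcases hs0.eq_or_lt with rfl | hpos
        · exact Or.inl (Or.inl h0)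
        · exact Or.inr ⟨s, hpos, rfl⟩
      · exact Or.inr ⟨r, zero_lt_one.trans_le hr, rfl⟩
      · exact Or.inl (Or.inr rfl)
    · rintro ((rfl | rfl) | ⟨s, hs, rfl⟩)
      · exact Or.inl ⟨0, ⟨le_rfl, zero_le_one⟩, h0⟩
      · exact Or.inr (Or.inr rfl)
      · rcases le_or_gt s 1 with hs1 | hs1
        · exact Or.inl ⟨s, ⟨hs.le, hs1⟩, rfl⟩
        · exact Or.inr (Or.inl ⟨s, hs1.le, rfl⟩)
  refine ⟨c, hc, hcs, hct, fun t => ?_, by rw [hrange, htrace]⟩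
  have ht : c t ∈ range c := ⟨t, rfl⟩
  rw [hrange] at ht
  simp only [mem_union, mem_image, mem_Icc, mem_Ici, mem_singleton_iff] at ht
  rcases ht with ⟨s, ⟨hs0, -⟩, hs⟩ | ⟨r, hr, hrx⟩ | hb
  · rcases hs0.eq_or_lt with rfl | hpos
    · exact Or.inl (hs ▸ h0.symm ▸ rfl)
    · exact Or.inr (Or.inr (hs ▸ hΦD _ (ray_im_pos hw hpos)))
  · exact Or.inr (Or.inr (hrx ▸ hΦD _ (ray_im_pos hw (zero_lt_one.trans_le hr))))
  · exact Or.inr (Or.inl hb)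

/-- `ray_curve` for the boundary extension of a chordal uniformizer. -/
theorem ray_curve_bExt {D : DobrushinDomain} {φ : ConformalEquiv upperHalfPlaneSet D.carrier}
    (hφ : D.IsChordalUniformizing φ) {w : ℂ} (hw : 0 < w.im) :
    ∃ c : Curve ℂ, Injective c ∧ c.source = D.pt 0 ∧ c.target = D.pt 1 ∧
      (∀ t, c t = D.pt 0 ∨ c t = D.pt 1 ∨ c t ∈ D.carrier) ∧
      range c = {D.pt 0, D.pt 1} ∪ ((fun s : ℝ => φ.boundaryExtension ((s : ℂ) * w)) '' Ioi 0) :=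
  ray_curve (D.pt_injective.ne (by decide)) (continuousOn_boundaryExtension_im_nonneg φ)
    (FaithfulAttach.bext_injOn φ) hφ.boundaryExtension_zero (fun _ hz => FaithfulAttach.bext_mem_carrier φ hz)
    (fun _ hz => FaithfulAttach.bext_ne_pt_one hφ hz) hφ.tendsto_boundaryExtension_cocompact hw

/-- `Φ` is injective along every ray of `ℍ`: `Φ (s w) = Φ w`, `s > 0` forces `s = 1`. -/
theorem ray_param_eq_one {D : DobrushinDomain} (φ : ConformalEquiv upperHalfPlaneSet D.carrier) {w : ℂ}
    (hw : 0 < w.im) (s : ℝ) (hs : 0 < s) (h : φ.boundaryExtension ((s : ℂ) * w) = φ.boundaryExtension w) :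
    s = 1 := by
  have hw0 : w ≠ 0 := by intro h'; rw [h'] at hw; simp at hw
  have h1 := FaithfulAttach.bext_injOn φ (ray_im_nonneg hw.le hs.le) hw.le h
  have h2 : (s : ℂ) = 1 := mul_right_cancel₀ hw0 (h1.trans (one_mul w).symm)
  exact_mod_cast h2

/-! ### The junk direction -/

/-- The junk value of the route's `ψ₁` outside `closure D`: `invFunOn Φ ℍ̄ m = Classical.choice _`. -/
theorem hinv_eq_choice {D : DobrushinDomain} (φ : ConformalEquiv upperHalfPlaneSet D.carrier) {m : ℂ}
    (hm : m ∉ closure D.carrier) :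
    hinv φ.boundaryExtension m = Classical.choice (⟨0⟩ : Nonempty ℂ) := by
  rw [hinv_apply, Function.invFunOn_neg]
  rintro ⟨z, hz, hzm⟩
  exact hm (hzm ▸ FaithfulAttach.bext_mem_closure φ hz)

/-- If `J ∈ ℍ` is off the imaginary axis, so is its squeeze `A_e J` (`0 < e ≤ 1/2`): the squeeze fixes
the direction `π/2`. -/
theorem squeeze_re_ne_zero {e : ℝ} (he : 0 < e) (he' : e ≤ 1 / 2) {J : ℂ} (hJ : 0 < J.im) (hJ' : J.re ≠ 0) :
    0 < (squeeze e J).im ∧ (squeeze e J).re ≠ 0 := by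
  have hJ0 : J ≠ 0 := by intro h; rw [h] at hJ; simp at hJ
  have him := sqz_im_pos he he' (squeeze_spec' e) hJ.le hJ0
  refine ⟨him, fun hre => hJ' ?_⟩
  have harg : arg (squeeze e J) = Real.pi / 2 := arg_eq_pi_div_two_iff.2 ⟨hre, him⟩
  rw [sqz_arg he he' (squeeze_spec' e) hJ.le hJ0] at harg
  have hπ : Real.pi ≠ 0 := Real.pi_pos.ne'
  have hk : (1 - 2 * e / Real.pi) ≠ 0 := by
    rw [sub_ne_zero, Ne, eq_comm, div_eq_one_iff_eq hπ]; intro h; linarith [Real.pi_gt_three]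
  have hJarg : arg J = Real.pi / 2 := by
    have : (1 - 2 * e / Real.pi) * arg J = (1 - 2 * e / Real.pi) * (Real.pi / 2) := by
      rw [show (1 - 2 * e / Real.pi) * (Real.pi / 2) = Real.pi / 2 - e by field_simp]
      linarith
    exact mul_left_cancel₀ hk this
  exact (arg_eq_pi_div_two_iff.1 hJarg).1

/-! ### The theorem -/

/-- **`AttachReversal` is false if `Classical.choice ‹Nonempty ℂ›` lies in the open upper half-plane
off the imaginary axis.** Witness: the unit disc, any two uniformizers, `δ = 1`, the trivial walk at
the site `(2, 0)` (mesh point `2 ∉ closure 𝔻`), and the two ray attachments of `ray_curve_bExt`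
through `w = A_{1/2} (Classical.choice _)`: all hypotheses hold, yet the two traces are the images of
the rays through `w` and through `ι w = -1/(c w)`, which differ because `w ∉ iℝ`. -/
theorem AttachReversal_false_of_choice (hJ : 0 < (Classical.choice (⟨0⟩ : Nonempty ℂ)).im)
    (hJ' : (Classical.choice (⟨0⟩ : Nonempty ℂ)).re ≠ 0) :
    ¬ Theses.SAWReversalUpgrade.AttachReversal := by
  rw [attachReversal_iff]
  intro H
  -- the domain, the uniformizers, the site
  obtain ⟨φ, hφ⟩ := MarkedDomain.exists_isChordalUniformizing_holds DobrushinDomain.unitDisc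
  obtain ⟨φ', hφ'⟩ := MarkedDomain.exists_isChordalUniformizing_holds DobrushinDomain.unitDisc.swap
  obtain ⟨c₀, hc₀, heq⟩ := exists_eqOn_swap hφ hφ'
  have hcar : DobrushinDomain.unitDisc.carrier = ball (0:ℂ) 1 := rfl
  have hm : meshPoint 1 (![2, 0] : Site 2) = 2 := by
    apply Complex.ext <;> simp [meshPoint_re, meshPoint_im]
  have hm_out : (2 : ℂ) ∉ closure DobrushinDomain.unitDisc.carrier := by
    rw [hcar, closure_ball (0:ℂ) one_ne_zero, mem_closedBall_zero_iff]
    norm_num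
  have hma : DobrushinDomain.unitDisc.pt 0 ≠ 2 := fun h => hm_out (h ▸ FaithfulAttach.pt_mem_closure _ 0)
  have hmb : (2 : ℂ) ≠ DobrushinDomain.unitDisc.pt 1 := fun h => hm_out (h.symm ▸ FaithfulAttach.pt_mem_closure _ 1)
  have hmb' : DobrushinDomain.unitDisc.pt 1 ≠ 2 := fun h => hmb h.symm
  have hma' : (2 : ℂ) ≠ DobrushinDomain.unitDisc.pt 0 := fun h => hma h.symm
  -- the junk direction
  have he : (0:ℝ) < min 1 (1/2) := by norm_num
  have he' : min (1:ℝ) (1/2) ≤ 1 / 2 := min_le_right _ _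
  obtain ⟨hw, hw_re⟩ := squeeze_re_ne_zero he he' hJ hJ'
  have hψ : squeeze (min (1:ℝ) (1/2)) (hinv φ.boundaryExtension 2) =
      squeeze (min (1:ℝ) (1/2)) (Classical.choice (⟨0⟩ : Nonempty ℂ)) := by rw [hinv_eq_choice φ hm_out]
  have hψ' : squeeze (min (1:ℝ) (1/2)) (hinv φ'.boundaryExtension 2) =
      squeeze (min (1:ℝ) (1/2)) (Classical.choice (⟨0⟩ : Nonempty ℂ)) := by
    rw [hinv_eq_choice (D := DobrushinDomain.unitDisc.swap) φ' hm_out]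
  -- the two ray attachments
  obtain ⟨c, hc, hcs, hct, hcm, hcr⟩ := ray_curve_bExt hφ hw
  obtain ⟨c', hc', hcs', hct', hcm', hcr'⟩ := ray_curve_bExt hφ' hw
  -- the data of the constant polyline at `2`
  obtain ⟨hu, hv, hS⟩ := const_generic_data (Φ := φ.boundaryExtension) (e := min (1:ℝ) (1/2)) hma hmb hψ
    (fun s hs h => ray_param_eq_one φ hw s hs h)
  obtain ⟨hu', hv', hS'⟩ := const_generic_data (Φ := φ'.boundaryExtension) (e := min (1:ℝ) (1/2)) hmb' hma' hψ'
    (fun s hs h => ray_param_eq_one φ' hw s hs h)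
  -- instantiate the route statement at the trivial walk
  have key := H DobrushinDomain.unitDisc φ hφ φ' hφ' 1 ![2, 0] ![2, 0] ⟨SimpleGraph.Walk.nil, SimpleGraph.Walk.IsPath.nil⟩
    c c' one_pos ?_ ?_
  · -- the two traces coincide
    have hr : Set.range c' = Set.range c := by
      have := congrArg CurveClass.range key
      rwa [CurveClass.range_reverse, CurveClass.range_mk, CurveClass.range_mk] at this
    -- `Φ' w` lies on the primed trace, hence on the unprimed one: `Φ' w = Φ (s w)`, `s > 0`
    have hmem : φ'.boundaryExtension (((1:ℝ) : ℂ) * squeeze (min (1:ℝ) (1/2)) (Classical.choice (⟨0⟩ : Nonempty ℂ))) ∈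
        Set.range c := by
      rw [← hr, hcr']
      exact Or.inr ⟨1, mem_Ioi.2 zero_lt_one, rfl⟩
    rw [hcr, Complex.ofReal_one, one_mul] at hmem
    have hw' : 0 ≤ (squeeze (min (1:ℝ) (1/2)) (Classical.choice (⟨0⟩ : Nonempty ℂ))).im := hw.le
    have hw0 : squeeze (min (1:ℝ) (1/2)) (Classical.choice (⟨0⟩ : Nonempty ℂ)) ≠ 0 := by
      intro h; rw [h] at hw; simp at hw
    have hD : φ'.boundaryExtension (squeeze (min (1:ℝ) (1/2)) (Classical.choice (⟨0⟩ : Nonempty ℂ))) ∈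
        DobrushinDomain.unitDisc.carrier := FaithfulAttach.bext_mem_carrier (D := DobrushinDomain.unitDisc.swap) φ' hw
    rcases hmem with (h | h) | ⟨s, hs, hsw⟩
    · exact MarkedDomain.pt_notMem_carrier _ 0 (h ▸ hD)
    · exact MarkedDomain.pt_notMem_carrier _ 1 (h ▸ hD)
    -- `Φ' w = Φ (ι w)`, so `s w = ι w` by injectivity on `ℍ̄`, and the arguments disagree
    rw [bExt_swap_eq hc₀ heq hw' hw0] at hsw
    have hιim := negInv_im_nonneg hc₀ hw'
    have hsw' := FaithfulAttach.bext_injOn φ (ray_im_nonneg hw' hs.le) hιim hsw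
    have harg := congrArg arg hsw'
    rw [arg_real_mul _ hs, arg_negInv hc₀ hw' hw0] at harg
    have hpi : arg (squeeze (min (1:ℝ) (1/2)) (Classical.choice (⟨0⟩ : Nonempty ℂ))) = Real.pi / 2 := by linarith
    exact hw_re (arg_eq_pi_div_two_iff.1 hpi).1
  · -- `c` is standard for the unprimed data
    show c ∈ standardCurves (DobrushinDomain.unitDisc.pt 0) (DobrushinDomain.unitDisc.pt 1) φ.boundaryExtension
      (min 1 (1/2)) (projLine ((SimpleGraph.Walk.nil : (discreteDomainGraph DobrushinDomain.unitDisc.carrier 1).Walk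
        ![2, 0] ![2, 0]).toCurve (meshPoint 1))) DobrushinDomain.unitDisc.carrier
    rw [projLine_toCurve_nil, hm]
    refine ⟨hc, hcs, hct, hcm, fun _ => by rw [hcr, hS], fun h => ?_⟩
    exfalso; apply h; rw [hu, hv]; exact zero_lt_one
  · -- `c'` is standard for the primed data
    show c' ∈ standardCurves (DobrushinDomain.unitDisc.swap.pt 0) (DobrushinDomain.unitDisc.swap.pt 1)
      φ'.boundaryExtension (min 1 (1/2))
      (projLine ((SimpleGraph.Walk.nil : (discreteDomainGraph DobrushinDomain.unitDisc.carrier 1).Walk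
        ![2, 0] ![2, 0]).reverse.toCurve (meshPoint 1))) DobrushinDomain.unitDisc.swap.carrier
    rw [SimpleGraph.Walk.reverse_nil, projLine_toCurve_nil, hm, MarkedDomain.pt_swap_zero, MarkedDomain.pt_swap_one]
    refine ⟨hc', ?_, ?_, fun t => ?_, fun _ => by rw [hcr', MarkedDomain.pt_swap_zero, MarkedDomain.pt_swap_one, hS'], fun h => ?_⟩
    · rw [hcs', MarkedDomain.pt_swap_zero]
    · rw [hct', MarkedDomain.pt_swap_one]
    · rcases hcm' t with h | h | h
      · exact Or.inl (by rw [h, MarkedDomain.pt_swap_zero])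
      · exact Or.inr (Or.inl (by rw [h, MarkedDomain.pt_swap_one]))
      · exact Or.inr (Or.inr h)
    · exfalso; apply h; rw [hu', hv']; exact zero_lt_one

end Summit.CriticalPhenomena.SAWScalingLimit.Theorems.AttachReversal

end
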